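import Summits.QuantumFields.YangMills.Theorems.UnitScaleTiltFluctuationComparisonRegPrGlobalSlackKernelMatchingCompose
import Summits.QuantumFields.YangMills.Theorems.UnitScaleTiltFluctuationComparisonRegPrGlobalSlackLocalToGlobalPure

/-!
# `UnitScaleTiltFluctuationComparisonRegPrGlobalSlackChartsToGlobal` — THE END-TO-END BY-NAME COMPOSITION FOR STUB 3⁗: chart-calculus rows ⟹ local row ⟹ GLOBAL row
# (crux `FluctuationComparisonRegPrL`, stmt-QuantumFields-19935; OWNER RULING ym3-torus-plan g21-№3 §B «ONE consumer-facing name»)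

Seat ym3-torus-p2 g14.  Glue only (no new estimate): the K1a interface of ★ym-ust-19935-slack g0 (`…GlobalSlackKernelMatching{,Compose}`, port of ym-cruxidea-19201-1 g12:
`polymerCauchyMinAtTSlack_of_charts`, `polymerCauchyMinAtT_of_charts`) and this seat's local→global producer (`…GlobalSlackLocalToGlobal{,Pure}`, port of ym-cruxidea-19201-1 g11:
`globalTwoRunSlackTail_of_polymerSlack`, `globalTwoRunSlackTail_of_polymerPure`) state the per-polymer slack row in two namespaces with the SAME text; §1 records the identity
(`Iff.rfl`) and re-exports the producer on the K1a side's name (the consumer-facing one, OWNER g21-№3 §B), §2 composes END TO END: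

  SLACK LINE  `TaylorSplitΦ ∧ FlatKernelCauchyΦ ∧ KernelSizeΦ ∧ RemainderSmallΦ ∧ CfgSizeΦ ∧ CfgCauchyΦ(ℓ ≡ 1)`  (K1a interface, one chart family `Φ`)
            `∧ PintDecompTrivT ∧ LocCover ∧ LocBlockVolume ∧ LocMatched ∧ TermSizeTrivT`  ((43)–(46) bookkeeping of the same `(D, PT)`)
            ⟹ `∃ σ₀ C₀, 7 ≤ σ₀ ∧ 0 ≤ C₀ ∧ GlobalSlack.GlobalSupRateTSlack D b₀ p₀ a σ₀ C₀`   (`globalTwoRunSlackTail_of_charts`; = 3⁗'s tail after `∃ p … ∃ π`);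
  PURE LINE   the same with `PolySplitΦ` (no rest, OWNER g20-№11 ADDENDUM 3 of record) in place of `TaylorSplitΦ ∧ RemainderSmallΦ`  (`globalTwoRunSlackTail_of_chartsPure`),
with the explicit `K`-uniform constants kept in `globalSupRateTSlack_of_charts[Pure]`.  Side conditions collected once: `0 < γ ≤ 1`, `√γ ≤ e^{1−p₀}` (threshold monotonicity),
`0 < b₀`, `0 ≤ p₀`, `0 < a < 1`, non-negative constants, and the window `(C_s + C_B)·θ(n) ≤ 1` at every height.  What remains OPEN for 3⁗ is exactly the content of the rows
(K1a `FlatKernelCauchyΦ`, `CfgCauchyΦ`, the (α)-side display (M1)) for the family `D = dataOfV3 p π` — nothing in this file asserts them.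

References: C. King, CMP 102 (1986) 649–677 [King1986] (Thm 3.4 (3.9) p.656, Prop. 3.6 p.662); T. Bałaban, CMP 102 (1985) 255–275 [Balaban1985UV3] ((43)–(46) pp.266–267, (57) p.270).
-/

set_option autoImplicit false

noncomputable section

open scoped BigOperators
open Literature.MathematicalPhysics.QuantumFieldTheory.Balaban1983to89
open Literature.MathematicalPhysics.QuantumFieldTheory.Balaban1983to89.T3ContinuumYM3Torus
open Literature.MathematicalPhysics.QuantumFieldTheory.Balaban1983to89.T3UnitScaleTilt
open Literature.MathematicalPhysics.QuantumFieldTheory.Balaban1983to89.T3LevelShift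
open Literature.MathematicalPhysics.QuantumFieldTheory.Balaban1983to89.T3AlphaInputsAC
open Literature.MathematicalPhysics.QuantumFieldTheory.Balaban1983to89.T3AlphaPolymerSocket
open Literature.MathematicalPhysics.QuantumFieldTheory.Balaban1983to89.T3AlphaInputsACTwoRun
open Literature.MathematicalPhysics.QuantumFieldTheory.Balaban1983to89.T3AlphaInputsACTwoRunLevel
open Literature.MathematicalPhysics.QuantumFieldTheory.Balaban1983to89.T3Thresholds
open Summit.QuantumFields.YangMills.Theorems.GlobalSlack (GlobalSupRateTSlack)
open Summit.QuantumFields.YangMills.Theorems.GlobalSlackKernelMatching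

namespace Summit.QuantumFields.YangMills.Theorems.GlobalSlackChartsToGlobal

variable {𝕍 : Type} [NormedAddCommGroup 𝕍] [NormedSpace ℂ 𝕍] {F : T3Family} {γ : ℝ}

/-! ## §1 One text, two namespaces: the identity, and the producer re-exported on the K1a side's name -/

/-- The per-polymer slack row of the K1a interface (`GlobalSlackKernelMatching.PolymerCauchyMinAtTSlack`, p529311) and of the local→global producer
(`GlobalSlackLocalToGlobal.PolymerCauchyMinAtTSlack`, p530498) are the same text (both verbatim ideator 1 g9 §1). [folklore] -/
theorem polymerCauchyMinAtTSlack_iff (D : AlphaDataT3 F γ) (PT : TermFn F) (b₀ p₀ κ₁ a : ℝ) (σ : ℕ) (C : ℝ) :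
    GlobalSlackKernelMatching.PolymerCauchyMinAtTSlack D PT b₀ p₀ κ₁ a σ C ↔
      GlobalSlackLocalToGlobal.PolymerCauchyMinAtTSlack D PT b₀ p₀ κ₁ a σ C :=
  Iff.rfl

/-- **THE PRODUCER ON THE CONSUMER-FACING NAME**: `GlobalSlackKernelMatching.PolymerCauchyMinAtTSlack` + the five (43)–(46) bookkeeping rows ⟹ the global slack row with the
`K`-uniform constant `max(C′,0)·(C_T + C/(1 − L^{a−1}) + C/(1 − L⁻¹))` (`GlobalSlackLocalToGlobal.globalSupRateTSlack_of_polymerSlack` through `Iff.rfl`).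
[cite: King1986, Thm 3.4 (3.9) p.656; Balaban1985UV3, (43)-(46) pp.266-267] -/
theorem globalSupRateTSlack_of_polymerSlackKM {D : AlphaDataT3 F γ} {PT : TermFn F} {b₀ p₀ κ₁ a C C_T C' : ℝ} {σ : ℕ}
    (hγ : 0 < γ) (hγ1 : γ ≤ 1) (hγe : Real.sqrt γ ≤ Real.exp (1 - p₀)) (hb : 0 < b₀) (hp : 0 ≤ p₀)
    (ha : 0 < a) (ha1 : a < 1) (hC : 0 ≤ C) (hCT : 0 ≤ C_T)
    (hdec : PintDecompTrivT D PT) (hLC : LocCover D κ₁ C') (hBV : LocBlockVolume D) (hLM : LocMatched D)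
    (hTS : TermSizeTrivT D PT b₀ p₀ C_T κ₁) (hPC : GlobalSlackKernelMatching.PolymerCauchyMinAtTSlack D PT b₀ p₀ κ₁ a σ C) :
    GlobalSupRateTSlack D b₀ p₀ a σ (max C' 0 * (C_T + C / (1 - (F.L : ℝ) ^ (a - 1)) + C / (1 - (F.L : ℝ)⁻¹))) :=
  GlobalSlackLocalToGlobal.globalSupRateTSlack_of_polymerSlack hγ hγ1 hγe hb hp ha ha1 hC hCT hdec hLC hBV hLM hTS
    ((polymerCauchyMinAtTSlack_iff D PT b₀ p₀ κ₁ a σ C).1 hPC)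

/-! ## §2 END TO END: chart rows + bookkeeping rows ⟹ 3⁗'s tail -/

/-- **SLACK LINE, EXPLICIT CONSTANTS** (PROVED; glue of `polymerCauchyMinAtTSlack_of_charts` and the producer): the six K1a chart rows over one chart family `Φ` (rest `R`,
loss-free configuration comparison) and the five bookkeeping rows of the same `(D, PT)` give `GlobalSupRateTSlack D b₀ p₀ a 7 (max(C′,0)·(C_T + C₇/(1 − L^{a−1}) + C₇/(1 − L⁻¹)))`,
`C₇ = 5(C_s²C + 6C_sC_BC_E) + 2C_R`, on `0 < γ ≤ 1`, `√γ ≤ e^{1−p₀}`, `0 < b₀`, `0 ≤ p₀`, `0 < a < 1`, window `(C_s + C_B)θ(n) ≤ 1`.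
[cite: King1986, Prop. 3.6 p.662, Thm 3.4 (3.9) p.656; Balaban1985UV3, (30) p.263, (43)-(46) pp.266-267, (57) p.270] -/
theorem globalSupRateTSlack_of_charts {D : AlphaDataT3 F γ} {PT : TermFn F} {Φ : ChartFam 𝕍 F} {e : VacFam F} {B : CfgFam 𝕍 F} {R : RemFam F}
    {b₀ p₀ κ a C C_E C_R C_s C_B C_T C' : ℝ}
    (hγ : 0 < γ) (hγ1 : γ ≤ 1) (hγe : Real.sqrt γ ≤ Real.exp (1 - p₀)) (hb : 0 < b₀) (hp : 0 ≤ p₀) (ha : 0 < a) (ha1 : a < 1)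
    (hC : 0 ≤ C) (hCE : 0 ≤ C_E) (hCR : 0 ≤ C_R) (hCs : 0 ≤ C_s) (hCB : 0 ≤ C_B) (hCT : 0 ≤ C_T)
    (hθ1 : ∀ n, (C_s + C_B) * θBal F.L γ b₀ p₀ n ≤ 1)
    (hT : TaylorSplitΦ PT Φ e B R) (hK : FlatKernelCauchyΦ D Φ κ a C) (hE : KernelSizeΦ D Φ κ C_E)
    (hR : RemainderSmallΦ D R b₀ p₀ κ C_R) (hS : CfgSizeΦ D B b₀ p₀ C_s) (hBC : CfgCauchyΦ D B b₀ p₀ a C_B fun _ => 1)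
    (hdec : PintDecompTrivT D PT) (hLC : LocCover D κ C') (hBV : LocBlockVolume D) (hLM : LocMatched D) (hTS : TermSizeTrivT D PT b₀ p₀ C_T κ) :
    GlobalSupRateTSlack D b₀ p₀ a 7
      (max C' 0 * (C_T + (5 * (C_s ^ 2 * C + 6 * C_s * C_B * C_E) + 2 * C_R) / (1 - (F.L : ℝ) ^ (a - 1)) +
        (5 * (C_s ^ 2 * C + 6 * C_s * C_B * C_E) + 2 * C_R) / (1 - (F.L : ℝ)⁻¹))) := by
  have hLn : 1 ≤ F.L := F.hL.2.le
  have hL : (1 : ℝ) ≤ (F.L : ℝ) := by exact_mod_cast hLn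
  have hθ0 : ∀ n, 0 ≤ θBal F.L γ b₀ p₀ n := fun n => (T3MinimiserStabilityReduction.θBal_pos hLn hγ hγ1 hb p₀ n).le
  have h7 : 0 ≤ 5 * (C_s ^ 2 * C + 6 * C_s * C_B * C_E) + 2 * C_R := by positivity
  exact globalSupRateTSlack_of_polymerSlackKM hγ hγ1 hγe hb hp ha ha1 h7 hCT hdec hLC hBV hLM hTS
    (polymerCauchyMinAtTSlack_of_charts hC hCE hCR hCs hCB hL hθ0 hθ1 hT hK hE hR hS hBC)

/-- **SLACK LINE ⟹ THE TAIL OF STUB 3⁗** (PROVED): under the hypotheses of `globalSupRateTSlack_of_charts`,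
`∃ σ₀ C₀, 7 ≤ σ₀ ∧ 0 ≤ C₀ ∧ GlobalSupRateTSlack D b₀ p₀ a σ₀ C₀` — the registered `stub_globalTwoRunSlackFam`'s conclusion after `∃ p … ∃ π`, for `D` the lane's datum.
[cite: King1986, Thm 3.4 (3.9) p.656; Balaban1985UV3, (43)-(46) pp.266-267 and (57) p.270] -/
theorem globalTwoRunSlackTail_of_charts {D : AlphaDataT3 F γ} {PT : TermFn F} {Φ : ChartFam 𝕍 F} {e : VacFam F} {B : CfgFam 𝕍 F} {R : RemFam F}
    {b₀ p₀ κ a C C_E C_R C_s C_B C_T C' : ℝ}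
    (hγ : 0 < γ) (hγ1 : γ ≤ 1) (hγe : Real.sqrt γ ≤ Real.exp (1 - p₀)) (hb : 0 < b₀) (hp : 0 ≤ p₀) (ha : 0 < a) (ha1 : a < 1)
    (hC : 0 ≤ C) (hCE : 0 ≤ C_E) (hCR : 0 ≤ C_R) (hCs : 0 ≤ C_s) (hCB : 0 ≤ C_B) (hCT : 0 ≤ C_T)
    (hθ1 : ∀ n, (C_s + C_B) * θBal F.L γ b₀ p₀ n ≤ 1)
    (hT : TaylorSplitΦ PT Φ e B R) (hK : FlatKernelCauchyΦ D Φ κ a C) (hE : KernelSizeΦ D Φ κ C_E)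
    (hR : RemainderSmallΦ D R b₀ p₀ κ C_R) (hS : CfgSizeΦ D B b₀ p₀ C_s) (hBC : CfgCauchyΦ D B b₀ p₀ a C_B fun _ => 1)
    (hdec : PintDecompTrivT D PT) (hLC : LocCover D κ C') (hBV : LocBlockVolume D) (hLM : LocMatched D) (hTS : TermSizeTrivT D PT b₀ p₀ C_T κ) :
    ∃ (σ₀ : ℕ) (C₀ : ℝ), 7 ≤ σ₀ ∧ 0 ≤ C₀ ∧ GlobalSupRateTSlack D b₀ p₀ a σ₀ C₀ := by
  have hLn : 1 ≤ F.L := F.hL.2.le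
  have hL : (1 : ℝ) ≤ (F.L : ℝ) := by exact_mod_cast hLn
  have hθ0 : ∀ n, 0 ≤ θBal F.L γ b₀ p₀ n := fun n => (T3MinimiserStabilityReduction.θBal_pos hLn hγ hγ1 hb p₀ n).le
  have h7 : 0 ≤ 5 * (C_s ^ 2 * C + 6 * C_s * C_B * C_E) + 2 * C_R := by positivity
  exact GlobalSlackLocalToGlobal.globalTwoRunSlackTail_of_polymerSlack hγ hγ1 hγe hb hp ha ha1 h7 hCT le_rfl hdec hLC hBV hLM hTS
    ((polymerCauchyMinAtTSlack_iff D PT b₀ p₀ κ a 7 _).1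
      (polymerCauchyMinAtTSlack_of_charts hC hCE hCR hCs hCB hL hθ0 hθ1 hT hK hE hR hS hBC))

/-- **PURE LINE, EXPLICIT CONSTANTS** (PROVED; OWNER g20-№11 ADDENDUM 3 of record): print's polynomial structure `PolySplitΦ` (no rest) + K1a + kernel size + configuration
size + loss-free configuration comparison, and the five bookkeeping rows, give `GlobalSupRateTSlack D b₀ p₀ a σ (max(C′,0)·(C_T + C₅/(1 − L^{a−1}) + C₅/(1 − L⁻¹)))` for EVERY
`σ`, `C₅ = 5(C_s²C + 6C_sC_BC_E)` (`polymerCauchyMinAtT_of_charts` then `GlobalSlackLocalToGlobalPure.globalSupRateTSlack_of_polymerPure`).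
[cite: King1986, Prop. 3.6 p.662, Thm 3.4 (3.9) p.656; Balaban1985UV3, (33)-(34) p.264, (43)-(46) pp.266-267] -/
theorem globalSupRateTSlack_of_chartsPure {D : AlphaDataT3 F γ} {PT : TermFn F} {Φ : ChartFam 𝕍 F} {e : VacFam F} {B : CfgFam 𝕍 F}
    {b₀ p₀ κ a C C_E C_s C_B C_T C' : ℝ} (σ : ℕ)
    (hγ : 0 < γ) (hγ1 : γ ≤ 1) (hγe : Real.sqrt γ ≤ Real.exp (1 - p₀)) (hb : 0 < b₀) (hp : 0 ≤ p₀) (ha : 0 < a) (ha1 : a < 1)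
    (hC : 0 ≤ C) (hCE : 0 ≤ C_E) (hCs : 0 ≤ C_s) (hCB : 0 ≤ C_B) (hCT : 0 ≤ C_T)
    (hθ1 : ∀ n, (C_s + C_B) * θBal F.L γ b₀ p₀ n ≤ 1)
    (hP : PolySplitΦ PT Φ e B) (hK : FlatKernelCauchyΦ D Φ κ a C) (hE : KernelSizeΦ D Φ κ C_E)
    (hS : CfgSizeΦ D B b₀ p₀ C_s) (hBC : CfgCauchyΦ D B b₀ p₀ a C_B fun _ => 1)
    (hdec : PintDecompTrivT D PT) (hLC : LocCover D κ C') (hBV : LocBlockVolume D) (hLM : LocMatched D) (hTS : TermSizeTrivT D PT b₀ p₀ C_T κ) :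
    GlobalSupRateTSlack D b₀ p₀ a σ
      (max C' 0 * (C_T + 5 * (C_s ^ 2 * C + 6 * C_s * C_B * C_E) / (1 - (F.L : ℝ) ^ (a - 1)) +
        5 * (C_s ^ 2 * C + 6 * C_s * C_B * C_E) / (1 - (F.L : ℝ)⁻¹))) := by
  have hLn : 1 ≤ F.L := F.hL.2.le
  have hL : (1 : ℝ) ≤ (F.L : ℝ) := by exact_mod_cast hLn
  have hθ0 : ∀ n, 0 ≤ θBal F.L γ b₀ p₀ n := fun n => (T3MinimiserStabilityReduction.θBal_pos hLn hγ hγ1 hb p₀ n).le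
  have h5 : 0 ≤ 5 * (C_s ^ 2 * C + 6 * C_s * C_B * C_E) := by positivity
  exact GlobalSlackLocalToGlobalPure.globalSupRateTSlack_of_polymerPure σ hγ hγ1 hγe hb hp ha ha1 h5 hCT hdec hLC hBV hLM hTS
    (polymerCauchyMinAtT_of_charts hC hCE hCs hCB hL hθ0 hθ1 hP hK hE hS hBC)

/-- **PURE LINE ⟹ THE TAIL OF STUB 3⁗** (PROVED; `σ₀ = 7`): under the hypotheses of `globalSupRateTSlack_of_chartsPure`,
`∃ σ₀ C₀, 7 ≤ σ₀ ∧ 0 ≤ C₀ ∧ GlobalSupRateTSlack D b₀ p₀ a σ₀ C₀`. [cite: King1986, Thm 3.4 (3.9) p.656; Balaban1985UV3, (43)-(46) pp.266-267 and (57) p.270] -/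
theorem globalTwoRunSlackTail_of_chartsPure {D : AlphaDataT3 F γ} {PT : TermFn F} {Φ : ChartFam 𝕍 F} {e : VacFam F} {B : CfgFam 𝕍 F}
    {b₀ p₀ κ a C C_E C_s C_B C_T C' : ℝ}
    (hγ : 0 < γ) (hγ1 : γ ≤ 1) (hγe : Real.sqrt γ ≤ Real.exp (1 - p₀)) (hb : 0 < b₀) (hp : 0 ≤ p₀) (ha : 0 < a) (ha1 : a < 1)
    (hC : 0 ≤ C) (hCE : 0 ≤ C_E) (hCs : 0 ≤ C_s) (hCB : 0 ≤ C_B) (hCT : 0 ≤ C_T)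
    (hθ1 : ∀ n, (C_s + C_B) * θBal F.L γ b₀ p₀ n ≤ 1)
    (hP : PolySplitΦ PT Φ e B) (hK : FlatKernelCauchyΦ D Φ κ a C) (hE : KernelSizeΦ D Φ κ C_E)
    (hS : CfgSizeΦ D B b₀ p₀ C_s) (hBC : CfgCauchyΦ D B b₀ p₀ a C_B fun _ => 1)
    (hdec : PintDecompTrivT D PT) (hLC : LocCover D κ C') (hBV : LocBlockVolume D) (hLM : LocMatched D) (hTS : TermSizeTrivT D PT b₀ p₀ C_T κ) :
    ∃ (σ₀ : ℕ) (C₀ : ℝ), 7 ≤ σ₀ ∧ 0 ≤ C₀ ∧ GlobalSupRateTSlack D b₀ p₀ a σ₀ C₀ := by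
  have hLn : 1 ≤ F.L := F.hL.2.le
  have hL : (1 : ℝ) ≤ (F.L : ℝ) := by exact_mod_cast hLn
  have hθ0 : ∀ n, 0 ≤ θBal F.L γ b₀ p₀ n := fun n => (T3MinimiserStabilityReduction.θBal_pos hLn hγ hγ1 hb p₀ n).le
  have h5 : 0 ≤ 5 * (C_s ^ 2 * C + 6 * C_s * C_B * C_E) := by positivity
  exact GlobalSlackLocalToGlobalPure.globalTwoRunSlackTail_of_polymerPure hγ hγ1 hγe hb hp ha ha1 h5 hCT hdec hLC hBV hLM hTS
    (polymerCauchyMinAtT_of_charts hC hCE hCs hCB hL hθ0 hθ1 hP hK hE hS hBC)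

/-- **THE WINDOW CONDITION IS A THRESHOLD ON `γ`** (bookkeeping): for `0 ≤ C_s + C_B`, `0 < b₀`, `0 < p₀` there is `γ₁ ∈ (0,1]` (explicit, `T3Thresholds.θBal_le_of_le_gamma`) with
`(C_s + C_B)·θBal L γ b₀ p₀ n ≤ 1` at EVERY height `n` and every `L ≥ 1` for all `0 < γ ≤ γ₁` — so `hθ1` above is discharged along the route's «γ ≤ γ₁» prefix.
[cite: Balaban1985UV3, (7) p.257, p.267] -/
theorem exists_gamma_window {b₀ p₀ C_s C_B : ℝ} (hb : 0 < b₀) (hp : 0 < p₀) (hCsB : 0 ≤ C_s + C_B) :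
    ∃ γ₁ : ℝ, 0 < γ₁ ∧ γ₁ ≤ 1 ∧ ∀ (L : ℕ), 1 ≤ L → ∀ (γ : ℝ), 0 < γ → γ ≤ γ₁ → ∀ n, (C_s + C_B) * θBal L γ b₀ p₀ n ≤ 1 := by
  rcases hCsB.eq_or_lt with h0 | hpos
  · exact ⟨1, one_pos, le_rfl, fun L _ γ _ _ n => by rw [← h0, zero_mul]; exact zero_le_one⟩
  · set σ : ℝ := 1 / (C_s + C_B) with hσ
    have hσ0 : 0 ≤ σ := by positivity
    set γ₁ : ℝ := min 1 (((σ / (b₀ * ((2 * p₀) ^ p₀ * Real.exp (1 / 2 - p₀)))) ^ 2) ^ 2) with hγ₁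
    have hγ₁pos : 0 < γ₁ := by
      have hσpos : 0 < σ := by positivity
      have : 0 < ((σ / (b₀ * ((2 * p₀) ^ p₀ * Real.exp (1 / 2 - p₀)))) ^ 2) ^ 2 := by positivity
      exact lt_min one_pos this
    refine ⟨γ₁, hγ₁pos, min_le_left _ _, fun L hL γ hγ hγle n => ?_⟩
    have hγ1 : γ ≤ 1 := hγle.trans (min_le_left _ _)
    have hγσ : γ ≤ ((σ / (b₀ * ((2 * p₀) ^ p₀ * Real.exp (1 / 2 - p₀)))) ^ 2) ^ 2 := hγle.trans (min_le_right _ _)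
    have hθ := T3Thresholds.θBal_le_of_le_gamma hL hb hp hσ0 hγ hγ1 hγσ n
    calc (C_s + C_B) * θBal L γ b₀ p₀ n ≤ (C_s + C_B) * σ := mul_le_mul_of_nonneg_left hθ hpos.le
      _ = 1 := by rw [hσ]; field_simp

end Summit.QuantumFields.YangMills.Theorems.GlobalSlackChartsToGlobal

end
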